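import Summits.BirchSwinnertonDyer.BirchSwinnertonDyer.Theorems.QuadraticBranchSignedControlPlusEtaLowerInclusionFunctionalEquationSqueezeWeierstrass
import Summits.BirchSwinnertonDyer.BirchSwinnertonDyer.Theorems.QuadraticBranchSignedControlPlusEtaR1FunctionalEquationRows01
import HarnessLib

/-!
# Route `QuadraticBranchSignedControl` (rung K8, cell `bsd-potss`), crux `PlusEtaLowerInclusion`
# (item stmt-BirchSwinnertonDyer-19601): the FUNCTIONAL-EQUATION SQUEEZE, part 4 — the FACTORISATION-FREE
# road (`p ∤ coeff_{r+2} L_p⁺(V,η,T)` + ONE factor of `p`) and the census residue row `69150v1` re-issued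
# in the valuation-squeeze currency (seat `bsd-potss-k8eta-c1` g11; `--supports` 19601)

WHAT. Part 2 (p619760) proved (E⁺_η) ∧ (C1⁺_η) at a tower-onto pair from the named facts + B. D. Kim's
functional equation at `η` + ONE factor of `p` + the analytic SPLIT shape; part 3
(`span_singleton_eq_of_invol_of_unitCoeff`, Weierstrass preparation) removed the factorisation. THIS FILE:
§1 the road with the analytic input in the CURRENCY OF THE VALUATION SQUEEZE (p499967's `han` was
`p^{v+1} ∤ coeff_r Lη`; here `p ∤ coeff_{r+2} Lη` and `coeff_r Lη ≠ 0`, i.e. `μ(L_p⁺(V,η)) = 0`,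
`λ(L_p⁺(V,η)) ≤ r + 2` — read off PARI's `ellpadiclambdamu` and the series valuations alike); §2 the
Tamagawa-row version (`a = 1`); §3 the record shape and the row `69150v1` (`p = 5`, `r = 1`, `λ_η⁺ = 3`):
(E⁺_η) ∧ (C1⁺_η) for every tower-onto twist from {Kobayashi 1.2/1.3/2.2η/4.1η, Kitajima–Otsuki 1.3η,
Kim 3.11η, Poitou–Tate} + the kernel Tamagawa certificate (g10's `rowCheck_v69150v1`) + DISPLAYED
{`rank W ≤ 1`, tower onto, `V`-certificate, `5 ∤ coeff₃ L_5⁺(V,η,T)`, `coeff₁ ≠ 0`} — no height index, no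
factorisation data. On the 25 census rows with `λ_η⁺ = r + 2` this road asks for ONE factor of `p` only.

HONEST FRAMING (cell `bsd-potss`, run/shared/lean/pub/bsd-potss/; FULL-BSD rank ≤ 1 programme, HUMAN
RULING D-0036/D-0074): TOOL THEOREMS + ONE per-row instance, CONDITIONAL on the named Literature facts in
hypothesis position and on displayed per-pair inputs. Crux 19601 is OPEN class-wide and NOT closed; nothing
is booked; `BSD(W, p)` is claimed for no pair. No definition, no named fact, no `sorry`, axioms standard.

References: [KimBD2008MRL] Thm. 3.11 (p. 93); [Kobayashi2003] Thm. 2.2 (p. 5), §4 + Thm. 4.1 (p. 8), Thm. 9.3;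
[KitajimaOtsuki2018] Thm. 1.3; [MilneADT2006] I Thm. 4.10; [Washington1997] §7.1, §13.2;
[Cremona1997] Table 1 (label 69150v1).
-/

set_option autoImplicit false
set_option linter.dupNamespace false

noncomputable section

open scoped Classical AddSubgroup

open CongruenceSubgroup Field NumberField IsDedekindDomain WeierstrassCurve
open Literature.NumberTheory.EllipticCurves
open Literature.NumberTheory.EllipticCurves.ModularForms
open Literature.NumberTheory.GaloisRepresentations
open Literature.NumberTheory.GaloisCohomology
open Literature.NumberTheory.EllipticCurves.IwasawaDual
open Literature.NumberTheory.EllipticCurves.IwasawaAlgebra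
open Summit.BirchSwinnertonDyer.Rank1Residual.Additive
open Summit.BirchSwinnertonDyer.BirchSwinnertonDyer.Rank2Observatory.Tam
open Summit.BirchSwinnertonDyer.BirchSwinnertonDyer.Rank1Residual.X11RankOne

namespace Summit.BirchSwinnertonDyer.BirchSwinnertonDyer.Theorems

/-! ## §1 The road: (E⁺_η) ∧ (C1⁺_η) from `p ∤ coeff_{r+2} L_p⁺(V,η,T)` and ONE factor of `p` -/

section Pair

variable {V : WeierstrassCurve ℚ} [V.IsElliptic] [V.IsGloballyMinimal] {p : ℕ} [hp : Fact p.Prime]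

/-- **(E⁺_η) AT A TOWER-ONTO PAIR — the factorisation-free functional-equation squeeze.** GRANTED
Kobayashi's Thm. 1.2 / 1.3 / 2.2(η) / 4.1(η), Kitajima–Otsuki's Thm. 1.3 at `η` and B. D. Kim's Thm. 3.11
at `η` (NAMED facts), on a good `a_p = 0` pair with `p ≥ 5`, `ρ_{V,p^m}` onto, the `V`-certificate, the
ANALYTIC certificate `han2` (`coeff_r L_p⁺(V,η,T) ≠ 0` and `p ∤ coeff_{r+2} L_p⁺(V,η,T)`,
`r = rank V^{(p*)}(ℚ)`, for every branch function — they differ by units) and the ALGEBRAIC input `htors`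
(`p ∣ #(X_η/TX_η)_tors` for every `η`-datum — ONE factor of `p`): (E⁺_η)(V, p). CONDITIONAL; closes
nothing class-wide. [cite: KimBD2008MRL, Thm. 3.11 (p. 93)]
[cite: Kobayashi2003, Thm. 2.2 (p. 5), Thm. 4.1 and §4 (p. 8)] [cite: KitajimaOtsuki2018, Thm. 1.3]
[cite: Washington1997, §7.1 Thm. 7.3] -/
theorem quadraticBranchPlusEtaLowerInclusionAt_of_namedFacts_of_invol_of_unitCoeff_of_torsionDvd
    (h12 : Kobayashi2003.thm12_signedSelmerDual_finite_torsion)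
    (h13 : Kobayashi2003.thm41_signedCharIdeal_divisibility)
    (h22 : Kobayashi2003.thm22_etaSignedSelmerDual_finite_torsion)
    (h41 : Kobayashi2003.thm41_plusEtaCharIdeal_dvd)
    (hKO : KitajimaOtsuki2018.mainThm13_etaSignedSelmerDual_noFiniteSubmodule)
    (hFE : Kim2008.thm311_etaSignedSelmerDual_charIdeal_map_invol)
    (hp5 : 5 ≤ p) (hgood : V.HasGoodReductionAtPrime p) (hap : V.frobeniusTrace p = 0)
    (hsurj : ∀ m : ℕ, V.HasSurjectiveModNGaloisRep (p ^ m : ℕ))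
    (hcertV : ∀ {N : ℕ} [NeZero N] (f : CuspForm (Gamma0 N) 2), IsNewformOf V f →
      ∃ L : IwasawaAlgebra p, Kobayashi2003.IsSignedPAdicLFunction f p 1 L ∧
        IsUnit (PowerSeries.coeff V.mordellWeilRank L))
    (han2 : ∀ {N : ℕ} [NeZero N] {f : CuspForm (Gamma0 N) 2}, IsNewformOf V f →
      ∀ (ϖ : ℚ), (if Even (p / 2) then (ϖ : ℝ) * V.realPeriodRat = plusPeriod f
          else (ϖ : ℝ) * V.imaginaryPeriodRat = minusPeriod f) →
      ∀ (Lη : IwasawaAlgebra p), IsQuadraticBranchPlusLFunction f p ϖ Lη →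
        PowerSeries.coeff (V.quadraticTwist ((-1) ^ (p / 2) * p)).mordellWeilRank Lη ≠ 0 ∧
          ¬ (p : ℤ_[p]) ∣ PowerSeries.coeff ((V.quadraticTwist ((-1) ^ (p / 2) * p)).mordellWeilRank + 2) Lη)
    (htors : ∀ (K₀ : Type) [Field K₀] [NumberField K₀] [IsCyclotomicExtension {p} ℚ K₀]
      [(galRange (K := ℚ) K₀).Normal] (ηq : absoluteGaloisGroup ℚ →* ℤˣ),
      (∀ σ ∈ galRange (K := ℚ) K₀, ηq σ = 1) → ηq ≠ 1 →
      ∀ (κ : ZpExtension ℚ p) (γ : absoluteGaloisGroup ℚ),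
        κ.IsCyclotomic → κ.IsTopGenerator γ → γ ∈ galRange (K := ℚ) K₀ → IsCyclotomicVariable p γ →
      ∀ {N : ℕ} [NeZero N] {f : CuspForm (Gamma0 N) 2}, IsNewformOf V f →
      ∀ (ϖ : ℚ), (if Even (p / 2) then (ϖ : ℝ) * V.realPeriodRat = plusPeriod f
          else (ϖ : ℝ) * V.imaginaryPeriodRat = minusPeriod f) →
      ∀ (Lη : IwasawaAlgebra p), IsQuadraticBranchPlusLFunction f p ϖ Lη →
        PowerSeries.coeff (V.quadraticTwist ((-1) ^ (p / 2) * p)).mordellWeilRank Lη ≠ 0 →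
      ∀ (D : EtaSignedSelmerDualData V κ K₀ ℚ_[p] ηq γ 1),
        p ∣ Nat.card (AddCommGroup.torsion (IwasawaAlgebra.coinvariants p D.X))) :
    QuadraticBranchPlusEtaLowerInclusionAt V p := by
  intro K₀ _ _ _ _ ηq hηK hη1 N _ f hp2 hgood' hap' hf ϖ hϖ Lη hL κ γ hκ hγ hγK hγc D
  obtain ⟨hfin, htor⟩ :=
    EtaSignedSelmerDualData.finite_isTorsion_of_thm22 h22 hηK hp2 hgood' hap' hκ hγ hγK D
  haveI : Module.Finite (IwasawaAlgebra p) D.X := hfin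
  obtain ⟨g, hg⟩ := (charIdeal_isPrincipal_holds p D.X).principal
  have hg' : D.charIdeal = Ideal.span {g} := hg
  -- Kato side: `g ∣ Lη`
  obtain ⟨-, hup⟩ := EtaSignedSelmerDualData.thm41_plus_of_facts h22 h41 hηK hη1 hp2 hgood' hap' hf
    ϖ hϖ Lη hL hκ hγ hγK hγc D
  have hgL : g ∣ Lη := by
    have h := hup hsurj
    rw [hg', Ideal.span_singleton_le_span_singleton] at h
    exact h
  obtain ⟨hne, hunit⟩ := han2 hf ϖ hϖ Lη hL
  -- rank bound, leading coefficient, torsion divisibility: `p ∣ coeff_r g`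
  have hXg := X_pow_twistRank_dvd_etaCharGenerator_of_namedFacts_of_certV h12 h13 h22 hp5 hgood hap
    hsurj (fun f hf => hcertV f hf) hf K₀ ηq hηK hη1 κ γ hκ hγ hγK hγc D hg'
  obtain ⟨w, hw⟩ := coeff_twistRank_etaCharGenerator_eq_unit_mul_card_coker_bockstein h12 h13 h22 h41
    hKO hp5 hgood hap hsurj (fun f hf => hcertV f hf) hf ϖ hϖ Lη hL hne K₀ ηq hηK hη1 κ γ hκ hγ hγK hγc
    D hg'
  obtain ⟨-, hdvd⟩ := ker_bockstein_eq_bot_and_natCard_torsion_coinvariants_dvd h12 h13 h22 h41 hKO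
    hp5 hgood hap hsurj (fun f hf => hcertV f hf) hf ϖ hϖ Lη hL hne K₀ ηq hηK hη1 κ γ hκ hγ hγK hγc D
  have hcoef : (p : ℤ_[p]) ∣
      PowerSeries.coeff (V.quadraticTwist ((-1) ^ (p / 2) * p)).mordellWeilRank g := by
    rw [hw]
    obtain ⟨c, hc⟩ := (htors K₀ ηq hηK hη1 κ γ hκ hγ hγK hγc hf ϖ hϖ Lη hL hne D).trans hdvd
    refine Dvd.dvd.mul_left ?_ _
    rw [hc, Nat.cast_mul]
    exact dvd_mul_right _ _
  -- the algebraic functional equation at `η` (B. D. Kim Thm. 3.11): `(g)` is `ι`-stable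
  have hι : Ideal.map (invol p) (Ideal.span {g}) = Ideal.span {g} := by
    have h := hFE p K₀ ηq hηK V (by omega) hgood' hap' κ γ hκ hγ hγK 1 D.toLiterature
    rw [EtaSignedSelmerDualData.charIdeal_toLiterature, hg'] at h
    exact h
  -- squeeze (part 3)
  have heq : Ideal.span {g} = Ideal.span {Lη} :=
    span_singleton_eq_of_invol_of_unitCoeff p hp2 hXg hgL hι hcoef hne hunit
  rw [← heq, ← hg']

/-- **(E⁺_η) ∧ (C1⁺_η) at a tower-onto pair from the factorisation-free squeeze.** CONDITIONAL; closes
nothing class-wide. [cite: KimBD2008MRL, Thm. 3.11 (p. 93)] [cite: Kobayashi2003, §4 and Thm. 4.1 (p. 8)] -/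
theorem quadraticBranchPlusEta_pair_of_namedFacts_of_invol_of_unitCoeff_of_torsionDvd
    (h12 : Kobayashi2003.thm12_signedSelmerDual_finite_torsion)
    (h13 : Kobayashi2003.thm41_signedCharIdeal_divisibility)
    (h22 : Kobayashi2003.thm22_etaSignedSelmerDual_finite_torsion)
    (h41 : Kobayashi2003.thm41_plusEtaCharIdeal_dvd)
    (hKO : KitajimaOtsuki2018.mainThm13_etaSignedSelmerDual_noFiniteSubmodule)
    (hFE : Kim2008.thm311_etaSignedSelmerDual_charIdeal_map_invol)
    (hp5 : 5 ≤ p) (hgood : V.HasGoodReductionAtPrime p) (hap : V.frobeniusTrace p = 0)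
    (hsurj : ∀ m : ℕ, V.HasSurjectiveModNGaloisRep (p ^ m : ℕ))
    (hcertV : ∀ {N : ℕ} [NeZero N] (f : CuspForm (Gamma0 N) 2), IsNewformOf V f →
      ∃ L : IwasawaAlgebra p, Kobayashi2003.IsSignedPAdicLFunction f p 1 L ∧
        IsUnit (PowerSeries.coeff V.mordellWeilRank L))
    (han2 : ∀ {N : ℕ} [NeZero N] {f : CuspForm (Gamma0 N) 2}, IsNewformOf V f →
      ∀ (ϖ : ℚ), (if Even (p / 2) then (ϖ : ℝ) * V.realPeriodRat = plusPeriod f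
          else (ϖ : ℝ) * V.imaginaryPeriodRat = minusPeriod f) →
      ∀ (Lη : IwasawaAlgebra p), IsQuadraticBranchPlusLFunction f p ϖ Lη →
        PowerSeries.coeff (V.quadraticTwist ((-1) ^ (p / 2) * p)).mordellWeilRank Lη ≠ 0 ∧
          ¬ (p : ℤ_[p]) ∣ PowerSeries.coeff ((V.quadraticTwist ((-1) ^ (p / 2) * p)).mordellWeilRank + 2) Lη)
    (htors : ∀ (K₀ : Type) [Field K₀] [NumberField K₀] [IsCyclotomicExtension {p} ℚ K₀]
      [(galRange (K := ℚ) K₀).Normal] (ηq : absoluteGaloisGroup ℚ →* ℤˣ),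
      (∀ σ ∈ galRange (K := ℚ) K₀, ηq σ = 1) → ηq ≠ 1 →
      ∀ (κ : ZpExtension ℚ p) (γ : absoluteGaloisGroup ℚ),
        κ.IsCyclotomic → κ.IsTopGenerator γ → γ ∈ galRange (K := ℚ) K₀ → IsCyclotomicVariable p γ →
      ∀ {N : ℕ} [NeZero N] {f : CuspForm (Gamma0 N) 2}, IsNewformOf V f →
      ∀ (ϖ : ℚ), (if Even (p / 2) then (ϖ : ℝ) * V.realPeriodRat = plusPeriod f
          else (ϖ : ℝ) * V.imaginaryPeriodRat = minusPeriod f) →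
      ∀ (Lη : IwasawaAlgebra p), IsQuadraticBranchPlusLFunction f p ϖ Lη →
        PowerSeries.coeff (V.quadraticTwist ((-1) ^ (p / 2) * p)).mordellWeilRank Lη ≠ 0 →
      ∀ (D : EtaSignedSelmerDualData V κ K₀ ℚ_[p] ηq γ 1),
        p ∣ Nat.card (AddCommGroup.torsion (IwasawaAlgebra.coinvariants p D.X))) :
    QuadraticBranchPlusEtaLowerInclusionAt V p ∧ QuadraticBranchPlusEtaMainConjectureAt V p := by
  have hE : QuadraticBranchPlusEtaLowerInclusionAt V p :=
    quadraticBranchPlusEtaLowerInclusionAt_of_namedFacts_of_invol_of_unitCoeff_of_torsionDvd h12 h13 h22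
      h41 hKO hFE hp5 hgood hap hsurj (fun f hf => hcertV f hf) (fun hf => han2 hf) htors
  exact ⟨hE, quadraticBranchPlusEtaMainConjectureAt_of_facts_of_surjective_of_etaLowerInclusion h22 h41
    hsurj hE⟩

end Pair

/-! ## §2 Tamagawa rows (`a = 1`) and the record shape -/

section Tamagawa

variable {p : ℕ} [hp : Fact p.Prime]

/-- **RECORD SHAPE — (E⁺_η) ∧ (C1⁺_η) on a two-Tamagawa-prime row by the factorisation-free FE squeeze.**
GRANTED the named facts (Kobayashi 1.2/1.3/2.2η/4.1η, Kitajima–Otsuki 1.3η, B. D. Kim 3.11η, Poitou–Tate),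
`p ≥ 5`, an integer equation `W₀` with a PASSING ROW CERTIFICATE `Es` and a list `L` of TWO listed primes
`≠ p` carrying the exact certified values `c` with `p ∥ c`, every other listed prime `≠ p` having certified
values prime to `p`, `W = W₀ ⊗ ℚ` globally minimal with `rank W(ℚ) ≤ 1` (DISPLAYED): for every globally
minimal `V` with `C • W^{(p*)} = V`, good at `p`, `a_p(V) = 0`, `ρ_{V,p^m}` onto, the `V`-certificate and
the ANALYTIC certificate `coeff_r L_p⁺(V,η,T) ≠ 0 ∧ p ∤ coeff_{r+2} L_p⁺(V,η,T)` (`r = rank W`):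
**(E⁺_η)(V,p) ∧ (C1⁺_η)(V,p)** (torsion slot `a = 1` by p515151 §1, `1 + r ≤ 2`). CONDITIONAL; closes
nothing class-wide. [cite: KimBD2008MRL, Thm. 3.11 (p. 93)] [cite: Kobayashi2003, Thm. 2.2 (p. 5), §4 and Thm. 4.1 (p. 8), Thm. 9.3]
[cite: KitajimaOtsuki2018, Thm. 1.3] [cite: MilneADT2006, Ch. I, Thm. 4.10] [cite: SilvermanATAEC1994, IV.9.4] -/
theorem etaPair_of_rowCheck_of_tamagawaPair_of_unitCoeff
    (h12 : Kobayashi2003.thm12_signedSelmerDual_finite_torsion)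
    (h13 : Kobayashi2003.thm41_signedCharIdeal_divisibility)
    (h22 : Kobayashi2003.thm22_etaSignedSelmerDual_finite_torsion)
    (h41 : Kobayashi2003.thm41_plusEtaCharIdeal_dvd)
    (hKO : KitajimaOtsuki2018.mainThm13_etaSignedSelmerDual_noFiniteSubmodule)
    (hFE : Kim2008.thm311_etaSignedSelmerDual_charIdeal_map_invol)
    (hPT : poitouTate_selmerStructure_duality_real ℚ) (hp5 : 5 ≤ p)
    {Es : List TamLocal} {W₀ : WeierstrassCurve ℤ} (hrow : TamLocal.rowCheck Es W₀ = true)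
    (L : List ℕ) (hout : ∀ E ∈ Es, E.p ∉ L → E.p = p ∨ ∀ c ∈ E.vals, ¬ p ∣ c)
    (hin : ∀ E ∈ Es, E.p ∈ L → E.vals = [E.c] ∧ p ∣ E.c ∧ ¬ p ^ 2 ∣ E.c)
    (hL : ∀ ℓ ∈ L, ℓ ∈ Es.map (·.p)) (hnd : L.Nodup) (hpL : p ∉ L) (hlen : L.length = 2)
    [(W₀.baseChange ℚ).IsElliptic] [hGM : (W₀.baseChange ℚ).IsGloballyMinimal]
    (hrW : (W₀.baseChange ℚ).mordellWeilRank ≤ 1)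
    (V : WeierstrassCurve ℚ) [V.IsElliptic] [V.IsGloballyMinimal] (C : VariableChange ℚ)
    (hCV : C • (W₀.baseChange ℚ).quadraticTwist ((-1) ^ (p / 2) * p) = V)
    (hgood : V.HasGoodReductionAtPrime p) (hap : V.frobeniusTrace p = 0)
    (hsurj : ∀ m : ℕ, V.HasSurjectiveModNGaloisRep (p ^ m : ℕ))
    (hcertV : ∀ {N : ℕ} [NeZero N] (f : CuspForm (Gamma0 N) 2), IsNewformOf V f →
      ∃ L : IwasawaAlgebra p, Kobayashi2003.IsSignedPAdicLFunction f p 1 L ∧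
        IsUnit (PowerSeries.coeff V.mordellWeilRank L))
    (han2 : ∀ {N : ℕ} [NeZero N] {f : CuspForm (Gamma0 N) 2}, IsNewformOf V f →
      ∀ (ϖ : ℚ), (if Even (p / 2) then (ϖ : ℝ) * V.realPeriodRat = plusPeriod f
          else (ϖ : ℝ) * V.imaginaryPeriodRat = minusPeriod f) →
      ∀ (Lη : IwasawaAlgebra p), IsQuadraticBranchPlusLFunction f p ϖ Lη →
        PowerSeries.coeff (V.quadraticTwist ((-1) ^ (p / 2) * p)).mordellWeilRank Lη ≠ 0 ∧
          ¬ (p : ℤ_[p]) ∣ PowerSeries.coeff ((V.quadraticTwist ((-1) ^ (p / 2) * p)).mordellWeilRank + 2) Lη) :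
    QuadraticBranchPlusEtaLowerInclusionAt V p ∧ QuadraticBranchPlusEtaMainConjectureAt V p := by
  obtain ⟨hpT, hT, hT1, hsum⟩ := TamagawaRoad.tamagawa_inputs_of_rowCheck hrow hGM p L hout hin hL hnd hpL
  have hd : ((-1 : ℚ) ^ (p / 2) * p) ≠ 0 :=
    mul_ne_zero (pow_ne_zero _ (by norm_num)) (Nat.cast_ne_zero.mpr hp.out.ne_zero)
  have hr : (V.quadraticTwist ((-1) ^ (p / 2) * p)).mordellWeilRank ≤ 1 := by
    rw [TamagawaRoad.mordellWeilRank_quadraticTwist_eq_of_smul_quadraticTwist_eq hd hCV]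
    exact hrW
  rw [TamagawaRoad.pl_eq_primesEquiv_symm p] at hpT hT
  refine quadraticBranchPlusEta_pair_of_namedFacts_of_invol_of_unitCoeff_of_torsionDvd h12 h13 h22 h41
    hKO hFE hp5 hgood hap hsurj (fun f hf => hcertV f hf) (fun hf => han2 hf) ?_
  intro K₀ _ _ _ _ ηq hηK hη1 κ γ hκ hγ hγK hγc N _ f hf ϖ hϖ Lη hL hne D
  have h := pow_dvd_natCard_torsion_coinvariants_of_namedFacts_of_poitouTate_of_tamagawa h12 h13 h22
    h41 hPT hp5 hgood hap hsurj (fun f hf => hcertV f hf) hf ϖ hϖ Lη hL hne (W₀.baseChange ℚ) C hCV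
    ((L.map pl).toFinset) hpT hT hT1 K₀ ηq hηK hη1 κ γ hκ hγ hγK hγc D 1 (by rw [hsum, hlen]; omega)
  rwa [pow_one] at h

end Tamagawa

/-! ## §3 The row `W = 69150v1`, valuation-squeeze currency -/

namespace PlusEtaR1FunctionalEquationRows

/-- **(E⁺_η) ∧ (C1⁺_η) at `p = 5` for EVERY tower-onto good supersingular twist of `W = 69150v1` from
`5 ∤ coeff₃ L_5⁺(V,η,T)` and the kernel Tamagawa certificate — no height index, no factorisation data**
(Cremona's `[1, 0, 0, -13263, 613017]`, additive `I₀*` at `5`, Tamagawa-`5` primes `2:5, 3:10`; the census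
RESIDUE row under the valuation squeeze). IN THE KERNEL: `Δ ≠ 0`, global minimality, the local Tamagawa
numbers (`PlusEtaR1HeightRows.rowCheck_v69150v1`, g10) ⇒ torsion slot `5 ∣ #(X_η/TX_η)_tors`. DISPLAYED:
`rank W(ℚ) ≤ 1`; on `V`: tower onto, the `V`-certificate, and the ANALYTIC certificate
`coeff_{rank W} L_5⁺(V,η,T) ≠ 0 ∧ 5 ∤ coeff_{rank W + 2} L_5⁺(V,η,T)` (kit j304242: valuations of
`5·H_η/ℓ⁻` are `[·, 2, 2, 0, …]` to 10 coefficients at precision 9, and PARI `ellpadiclambdamu(V,5,1,2)`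
= `[[3,3],[0,0]]`, i.e. `λ⁺ = 3`, `μ⁺ = 0`; `rank W = 1` by GZK at `r_an = 1`, displayed). NAMED FACTS:
Kobayashi 1.2/1.3/2.2η/4.1η, Kitajima–Otsuki 1.3η, B. D. Kim 3.11η, Poitou–Tate. A per-row instance; nothing
booked; `BSD(W,5)` not claimed; the class-wide crux is as open as before.
[cite: KimBD2008MRL, Thm. 3.11 (p. 93)] [cite: Kobayashi2003, §4 Even main conjecture and Thm. 4.1 (p. 8)]
[cite: KitajimaOtsuki2018, Thm. 1.3] [cite: MilneADT2006, Ch. I, Thm. 4.10] [cite: Cremona1997, Table 1 (label 69150v1)] -/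
theorem etaPair_r1_v69150v1_5_of_unitCoeff
    (h12 : Kobayashi2003.thm12_signedSelmerDual_finite_torsion)
    (h13 : Kobayashi2003.thm41_signedCharIdeal_divisibility)
    (h22 : Kobayashi2003.thm22_etaSignedSelmerDual_finite_torsion)
    (h41 : Kobayashi2003.thm41_plusEtaCharIdeal_dvd)
    (hKO : KitajimaOtsuki2018.mainThm13_etaSignedSelmerDual_noFiniteSubmodule)
    (hFE : Kim2008.thm311_etaSignedSelmerDual_charIdeal_map_invol)
    (hPT : poitouTate_selmerStructure_duality_real ℚ)
    (W : WeierstrassCurve ℚ) (hW : W = ⟨1, 0, 0, (-13263), 613017⟩)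
    (hrW : W.mordellWeilRank ≤ 1)
    (V : WeierstrassCurve ℚ) [V.IsElliptic] [V.IsGloballyMinimal] [Fact (5 : ℕ).Prime]
    (C : VariableChange ℚ) (hCV : C • W.quadraticTwist 5 = V)
    (hgood : V.HasGoodReductionAtPrime 5) (hap : V.frobeniusTrace 5 = 0)
    (hsurj : ∀ m : ℕ, V.HasSurjectiveModNGaloisRep (5 ^ m : ℕ))
    (hcertV : ∀ {N : ℕ} [NeZero N] (f : CuspForm (Gamma0 N) 2), IsNewformOf V f →
      ∃ L : IwasawaAlgebra 5, Kobayashi2003.IsSignedPAdicLFunction f 5 1 L ∧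
        IsUnit (PowerSeries.coeff V.mordellWeilRank L))
    (han2 : ∀ {N : ℕ} [NeZero N] {f : CuspForm (Gamma0 N) 2}, IsNewformOf V f →
      ∀ (ϖ : ℚ), (if Even (5 / 2) then (ϖ : ℝ) * V.realPeriodRat = plusPeriod f
          else (ϖ : ℝ) * V.imaginaryPeriodRat = minusPeriod f) →
      ∀ (Lη : IwasawaAlgebra 5), IsQuadraticBranchPlusLFunction f 5 ϖ Lη →
        PowerSeries.coeff W.mordellWeilRank Lη ≠ 0 ∧
          ¬ (5 : ℤ_[5]) ∣ PowerSeries.coeff (W.mordellWeilRank + 2) Lη) :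
    QuadraticBranchPlusEtaLowerInclusionAt V 5 ∧ QuadraticBranchPlusEtaMainConjectureAt V 5 := by
  subst hW
  have hb := IntModelTam.baseChange_rat_mk_int 1 0 0 (-13263) 613017
  haveI : ((⟨1, 0, 0, (-13263), 613017⟩ : WeierstrassCurve ℤ).baseChange ℚ).IsElliptic :=
    TamLocal.isElliptic_of_rowCheck PlusEtaR1HeightRows.rowCheck_v69150v1
  haveI : ((⟨1, 0, 0, (-13263), 613017⟩ : WeierstrassCurve ℤ).baseChange ℚ).IsGloballyMinimal := by
    rw [hb]; exact PlusEtaR1HeightRows.isGloballyMinimal_v69150v1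
  have hD : ((-1 : ℚ) ^ ((5 : ℕ) / 2) * ((5 : ℕ) : ℚ)) = 5 := by norm_num
  have h5 : (5 : ℚ) ≠ 0 := by norm_num
  have hrk : (V.quadraticTwist 5).mordellWeilRank =
      (⟨1, 0, 0, (-13263), 613017⟩ : WeierstrassCurve ℚ).mordellWeilRank :=
    TamagawaRoad.mordellWeilRank_quadraticTwist_eq_of_smul_quadraticTwist_eq h5 hCV
  refine etaPair_of_rowCheck_of_tamagawaPair_of_unitCoeff h12 h13 h22 h41 hKO hFE hPT (le_refl 5)
    PlusEtaR1HeightRows.rowCheck_v69150v1 [2, 3] (by decide) (by decide) (by decide) (by decide) (by decide)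
    rfl (hrW := by rw [hb]; exact hrW) V C (by rw [hb, hD]; exact hCV) hgood hap hsurj
    (fun f hf => hcertV f hf) ?_
  intro N _ f hf ϖ hϖ Lη hL
  rw [hD, hrk]
  exact han2 hf ϖ hϖ Lη hL

end PlusEtaR1FunctionalEquationRows

end Summit.BirchSwinnertonDyer.BirchSwinnertonDyer.Theorems

end
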